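import Summits.HodgeConjecture.HodgeConjecture.Theses.HeckePrymWeil
import Summits.HodgeConjecture.HodgeConjecture.Theorems.HeckePrymWeilHeckePrymAnchorsUpgrade
import Summits.HodgeConjecture.HodgeConjecture.Theorems.HeckePrymWeilWeilSixfoldsSqrtMinus7AimedPartnerOfFacts
import Summits.HodgeConjecture.HodgeConjecture.Theorems.HeckePrymWeilWeilSixfoldsSqrtMinus7OfSplitSecantClass
import Literature.AlgebraicGeometry.HodgeTheory.WeilClassesSixfolds
import HarnessLib.Audit

/-!
# Skeleton line `hyperbolic-eightfold-descent` for crux `WeilSixfoldsSqrtMinus7` (stmt-HodgeConjecture-1260)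
# — LEAD RESHAPE r7 (lead c3, `prover-line-stmt-HodgeConjecture-1260-c3-0`, 2026-08-16): the MARKMAN SPLIT

Route `HeckePrymWeil`, crux `WeilSixfoldsSqrtMinus7` (rung `(7,2)`): on every complex abelian SIXFOLD
`A` with `φ ≫ φ = -7` every rational `(3,3)`-class of the Weil plane
`Eig((𝟙+φ)^*, (1+i√7)⁶) ⊔ Eig((𝟙+φ)^*, (1-i√7)⁶) ⊆ H⁶(A(ℂ); ℂ)` is algebraic — ALL discriminants.

## State inherited (leads -0, c1, c2; everything below is IN THE TREE, sorry-free)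

* r6 of THIS line (lead c1, `Lines/hyperbolic_eightfold_descent.lean` before this reshape, evidence
  `WeilSixfoldsSqrtMinus7.lean` 17:39Z / `AimedPartnerOfFacts.lean` 18:19Z): ONE sorry = S1 = the route
  decl `HyperbolicEightfoldsSqrtMinus7` (item stmt-HodgeConjecture-14642); composition landed
  UNCONDITIONALLY as `…Theorems.WeilSixfoldsSqrtMinus7.HyperbolicEightfoldDescent.
  weilSixfoldsSqrtMinus7_of_hyperbolicEightfoldsSqrtMinus7 : HyperbolicEightfoldsSqrtMinus7 →
  WeilSixfoldsSqrtMinus7` (p119421; aimed CM partner `E × E` + Schoen descent `8 → 6`).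
* line `real-quadratic-base-change` (lead c2): COMPLETE modulo its transferred crux C⁺(F) =
  `stub_splitSecantClass` (Markman's RELATIVE secant programme over `L = ℚ(√-7, √t)` at
  `(d,e,n) = (6,4,6)`, open mathematics, promote-stub filed 19:50Z); composition
  `…RealQuadraticBaseChange.weilSixfoldsSqrtMinus7_of_splitSecantClass` (p123467).
* reductions to the route's transport crux `WeilVariationalHodge` (stmt-HodgeConjecture-14497, OPEN
  instance of Grothendieck's variational Hodge conjecture) + ONE Deligne named fact:
  `HeckePrymWeilLine.weilSixfoldsSqrtMinus7_of_weilVariationalHodge_of_reach` (CmLadderReach) and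
  `…_of_levelStructure` (HodgeWeilOfLevelStructure); 14642 itself is `blocked-on 14497` (its leads c0–c5).

## r7 = r6 with the split by discriminant made explicit (why: the registered open stub should be the
## TRUE residual of the crux as print states it, not a statement one dimension up)

The hyperbolic (`det H = -1`) sixfolds need no eightfold: they are Markman's theorem
(arXiv:2502.03415 Thm. 1.5.1), vendored as the named fact `Markman2025_weilClasses_algebraic_hyperbolicSixfold`
(typed over `weilClassesOf A φ 3 d` and `IsHyperbolicWeilType A φ 3 (d·ι^*a + φ^*ι^*a)`); the crux's
single-operator plane is contained in `weilClassesOf A φ 3 7` by the landed `HeckePrymWeilLine.stub_upgrade`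
at `(7,3)`.  So the crux = (Markman's fact) + (its restriction to the pairs `(A, φ)` admitting NO
hyperbolic `K`-symmetrised hyperplane class) — "outside this locus, the Hodge conjecture for Weil classes
on sixfolds remains completely open" (arXiv:2603.20268 p. 3).  Registered stubs of r7:

* `stub_markmanSplit` — the NAMED FACT `Markman2025_weilClasses_algebraic_hyperbolicSixfold` (published
  theorem; closes when a literature prover discharges `…_holds`; not worker-provable).
* `stub_nonHyperbolicSixfolds` — the NON-SPLIT RESIDUAL (open mathematics; no print theorem; implied by:
  S1 = `HyperbolicEightfoldsSqrtMinus7` (14642) via p119421 — `stub_nonHyperbolicSixfolds_of_hyperbolicEightfolds`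
  below; by C⁺(F) via p123467; by `WeilVariationalHodge` (14497) + Deligne's Weil family).

Composition `WeilSixfoldsSqrtMinus7_of` (sorry-free, concludes the crux BY NAME): by cases on the
existence of a hyperbolic `(ι, a)`.  Tree copy of the composition: `Theorems/
HeckePrymWeilWeilSixfoldsSqrtMinus7MarkmanSplit.lean` (`…Theorems.WeilSixfoldsSqrtMinus7.MarkmanSplit.
weilSixfoldsSqrtMinus7_of_markmanSplit_of_nonHyperbolic`, `…_iff_nonHyperbolic_of_markmanSplit`).

Wave: none possible (no worker-provable stub: one named fact of a 2025 paper, one open problem).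
Disproof file read (cycle 2b): typing faithful, no kill possible, `⊔` essential; nothing bites r7
(both stubs are HC-implied: `Markman…_of_hodgeConjectureFor`; the residual is a restriction of the crux).
-/

noncomputable section

set_option linter.dupNamespace false

open CategoryTheory
open Literature.AlgebraicGeometry Literature.AlgebraicGeometry.Motives
  Literature.AlgebraicGeometry.HodgeTheory
open Summit.HodgeConjecture.HodgeConjecture.Theses.HeckePrymWeil

namespace Summit.HodgeConjecture.HodgeConjecture.Cruxes.WeilSixfoldsSqrtMinus7.HyperbolicEightfoldDescent

/-! ### Stub 0 (r7): the hyperbolic components — Markman's split-sixfold theorem, a NAMED FACT -/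

/-- **Stub `stub_markmanSplit`** = the named fact `Markman2025_weilClasses_algebraic_hyperbolicSixfold`
(E. Markman, arXiv:2502.03415 Thm. 1.5.1: the Hodge–Weil classes of polarized abelian sixfolds of Weil
type with CM by `ℚ(√-d)` and discriminant `-1` are algebraic), verbatim. A published theorem recorded in
`Literature/AlgebraicGeometry/HodgeTheory/WeilClassesSixfolds.lean`; discharging it (`…_holds`) is a
literature-prover task (secant sheaves on `X × X̂`, Buchweitz–Flenner semiregularity), not a worker's. -/
theorem stub_markmanSplit : Markman2025_weilClasses_algebraic_hyperbolicSixfold := by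
  sorry

/-! ### Stub 1 (r7): the non-split residual — OPEN MATHEMATICS -/

/-- **Stub `stub_nonHyperbolicSixfolds`** — the crux restricted to the pairs `(A, φ)` (`dim A = 6`,
`φ² = -7`) admitting NO hyperbolic `K`-symmetrised hyperplane class `7·ι^*a + φ^*ι^*a` (`ι` a projective
embedding, `a ≠ 0` rational), i.e. to the NON-SPLIT components `det H ≠ -1` of the `ℚ(√-7)`-Weil locus
of sixfolds: every rational `(3,3)` class of the Weil plane is algebraic there. Open (arXiv:2603.20268
p. 3); implied by `HyperbolicEightfoldsSqrtMinus7` (stmt-14642, `stub_nonHyperbolicSixfolds_of_hyperbolicEightfolds`),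
by C⁺(F) (`weilSixfoldsSqrtMinus7_of_splitSecantClass`) and by `WeilVariationalHodge` (stmt-14497) with
Deligne's Weil family (`weilSixfoldsSqrtMinus7_of_weilVariationalHodge_of_reach`). -/
theorem stub_nonHyperbolicSixfolds :
    ∀ (A : AbelianVariety ℂ) (φ : A ⟶ A), A.dim = 6 → φ ≫ φ = -((7 : ℤ) • 𝟙 A) →
      (∀ (e : ProjectiveEmbedding A.X) (a : complexBetti (projectiveSpace e.n ℂ) 2),
          IsRationalClass a → a ≠ 0 →
            ¬ IsHyperbolicWeilType A φ 3
              ((7 : ℂ) • complexBetti.map e.ι 2 a +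
                complexBetti.map φ.hom.hom.hom 2 (complexBetti.map e.ι 2 a))) →
        ∀ c : complexBetti A.X 6, IsRationalClass c → IsOfHodgeType 6 A.X 6 3 3 c →
          c ∈ Module.End.eigenspace (complexBetti.map (𝟙 A + φ).hom.hom.hom 6).hom
                ((1 + Complex.I * (Real.sqrt (7 : ℝ) : ℂ)) ^ 6) ⊔
              Module.End.eigenspace (complexBetti.map (𝟙 A + φ).hom.hom.hom 6).hom
                ((1 - Complex.I * (Real.sqrt (7 : ℝ) : ℂ)) ^ 6) →
            c ∈ algebraicClasses A.X 3 := by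
  sorry

/-! ### The residual from the inherited reductions (sorry-free) -/

/-- **Stub 1 from S1 of r6**: `HyperbolicEightfoldsSqrtMinus7` (stmt-HodgeConjecture-14642) gives the whole
crux (p119421, unconditional), hence its non-split residual. [cite: Schoen1998HodgeWeilAddendum, §10] -/
theorem stub_nonHyperbolicSixfolds_of_hyperbolicEightfolds (h : HyperbolicEightfoldsSqrtMinus7) :
    type_of% stub_nonHyperbolicSixfolds :=
  fun A φ hA hφ _ c hr hH hW ↦
    Summit.HodgeConjecture.HodgeConjecture.Theorems.WeilSixfoldsSqrtMinus7.HyperbolicEightfoldDescent.weilSixfoldsSqrtMinus7_of_hyperbolicEightfoldsSqrtMinus7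
      h A φ hA hφ c hr hH hW

/-- **Stub 1 from the crux itself** (it is a restriction of the crux: the residual is not stronger). -/
theorem stub_nonHyperbolicSixfolds_of_crux (h : WeilSixfoldsSqrtMinus7) :
    type_of% stub_nonHyperbolicSixfolds :=
  fun A φ hA hφ _ c hr hH hW ↦ h A φ hA hφ c hr hH hW

/-! ### The composition (concludes the crux BY NAME; sorry-free glue) -/

/-- **`WeilSixfoldsSqrtMinus7` from the two stubs of r7.** Given `(A, φ)` and a rational `(3,3)` class
`c` of the Weil plane: EITHER some projective embedding `ι` and rational `a ≠ 0` make
`(A, φ, 7·ι^*a + φ^*ι^*a)` hyperbolic — then `c ∈ weilClassesOf A φ 3 7` (`stub_upgrade (7,3)`), `A.X` is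
smooth projective of dimension `2·3` (`AbelianVariety.isSmoothProjective_holds`) and Stub 0 (Markman)
applies — OR no such `(ι, a)` exists and Stub 1 applies verbatim. -/
theorem WeilSixfoldsSqrtMinus7_of
    (h0 : type_of% stub_markmanSplit) (h1 : type_of% stub_nonHyperbolicSixfolds) :
    Summit.HodgeConjecture.HodgeConjecture.Theses.HeckePrymWeil.WeilSixfoldsSqrtMinus7 := by
  intro A φ hA hφ c hr hH hW
  by_cases hhyp : ∃ (e : ProjectiveEmbedding A.X) (a : complexBetti (projectiveSpace e.n ℂ) 2),
      IsRationalClass a ∧ a ≠ 0 ∧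
        IsHyperbolicWeilType A φ 3
          ((7 : ℂ) • complexBetti.map e.ι 2 a +
            complexBetti.map φ.hom.hom.hom 2 (complexBetti.map e.ι 2 a))
  · obtain ⟨e, a, ha, ha0, hh⟩ := hhyp
    have hA' : A.dim = 2 * 3 := by rw [hA]
    have hX : IsSmoothProjective (2 * 3) A.X := by
      rw [← hA']
      exact AbelianVariety.isSmoothProjective_holds
    have hφ' : φ ≫ φ = -((((7 : ℕ) : ℤ)) • 𝟙 A) := by exact_mod_cast hφ
    have hφℕ : φ ≫ φ = -((7 : ℕ) • 𝟙 A) := by rw [hφ', natCast_zsmul]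
    have hWcl : c ∈ weilClassesOf A φ 3 7 :=
      Summit.HodgeConjecture.HodgeConjecture.Theorems.HeckePrymWeilLine.stub_upgrade 7 (by norm_num)
        (by norm_num) le_rfl 3 A φ hA' hφ' (by exact_mod_cast hW)
    have hhℕ : IsHyperbolicWeilType A φ 3
        ((((7 : ℕ) : ℂ)) • complexBetti.map e.ι 2 a +
          complexBetti.map φ.hom.hom.hom 2 (complexBetti.map e.ι 2 a)) := by
      exact_mod_cast hh
    exact h0 7 (by norm_num) A φ hA' hX hφℕ e a ha ha0 hhℕ c hr (by exact_mod_cast hH) hWcl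
  · push Not at hhyp
    exact h1 A φ hA hφ (fun e a ha ha0 ↦ hhyp e a ha ha0) c hr hH hW

/-- The crux from the stubs as they stand (depends on their `sorry`s; shows the composition closes). -/
theorem WeilSixfoldsSqrtMinus7_of_stubs :
    Summit.HodgeConjecture.HodgeConjecture.Theses.HeckePrymWeil.WeilSixfoldsSqrtMinus7 :=
  WeilSixfoldsSqrtMinus7_of stub_markmanSplit stub_nonHyperbolicSixfolds

end Summit.HodgeConjecture.HodgeConjecture.Cruxes.WeilSixfoldsSqrtMinus7.HyperbolicEightfoldDescent

end
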